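import Summits.QuantumFields.YangMills.Theorems.UnitScaleTiltProp7ThetaOfColumnLettersT3
import Summits.QuantumFields.YangMills.Theorems.UnitScaleTiltProp7BlockBumpExtension
import Summits.QuantumFields.YangMills.Theorems.UnitScaleTiltProp7TorusExpWeightSum
import Literature.MathematicalPhysics.QuantumFieldTheory.Balaban1983to89.T3PrintedRegularOrbits
import HarnessLib

/-!
# Route `UnitScaleTilt`, crux K1 «MinimiserStabilityRegPr» (stmt-QuantumFields-19200), stub EX — TWO FAMILY DOORS FOR THE EX DISPLAY (S19ᴸ∕S20ᴸ):
# **THE ∃-MAJORANT COLUMN ROWS `hHcol` (one-block column of `H̃ᴾ`) AND `hΔHcol` (composite `Δ̃^η∘H̃ᴾ`) FOLLOW FROM PRINT'S KERNEL-DECAY ROWS —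
# [Balaban1985BackgroundPropagators] Thm 3.12 (3.133) for `H` and [Balaban1985Variational] (88) ∕ [B9] (3.132) for `(Δ_π + DRD*)H` — BY ONE TORUS LATTICE SUM**

Cell `ym3-torus`, width seat `ym3-torus-px6` g5 (EX namer ★ym-ust-19200-w2 g7 2026-08-29T02:27:32Z «NEXT DOORS WANTED … `hHcol` (H̃ᴾ one-block column, [5] (3.133) — px6?),
`hΔHcol` ((88) composite column)»; base px6 g4's LOCATE «THETA-OF-W6» 46e408e5f8be67a4 §2 rows «H-COLUMN»∕«ΔH-COLUMN»).  THEOREMS ONLY (0 `def`, 0 `sorry`);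
`--supports stmt-QuantumFields-19200 --as helper`; count-neutral.  YM₃ on T³ is ladder rung R3, NOT d = 4, NOT the Clay problem; nothing here claims the stub, the crux, any
N06 estimate or the mass gap.

THE PRINT.  [Balaban1985BackgroundPropagators] (3.133) p. 422: *«|H_{μν}(x, y′)| … ≤ O(1)[1, …](L^{j′}η)^{−d}e^{−(1∕2)δ₁d(y,y′)}, for x ∈ Δ(y) … y ∈ Λ_j, y′ ∈ Λ_{j′}»*
(Thm 3.12 p. 423: «the inequality (3.133) together with Theorem 3.10 hold for the operators H, H₁»); at the one-level member `j = j′ = k = K − n`, `Lᵏη = 1`, so the volume factor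
`(L^{j′}η)^{−d} = 1` and `d(y, y′)` is the distance of the `k`-blocks on the unit (coarse) lattice.  [Balaban1985Variational] (88) p. 291: «`(Δ_π + DRD*)H = Q*(QGQ*)⁻¹ − Q*aQH`» with the
kernel of `(QGQ*)⁻¹` bounded by [B9] (3.132) p. 422 *«|(QGQ*)⁻¹(y, y′)| ≤ O(1)(Lʲη)⁻²(L^{j′}η)^{−d}e^{−δ₁d(y,y′)}»*.

WHY.  The EX display carries the one-block column letters of `H̃ᴾ := H1f … (DeltaPiSlotP …) U₀` and of the composite `Δ̃^η ∘ H̃ᴾ` as ∃-MAJORANT rows (`hHcol`, `hΔHcol`: «∃ hk ≥ 0, entry ≤ hk·‖Z‖,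
Σ_{b′} hk b′ y ≤ Θ·(L^{K−n})³»), the shape lit's kernel-column carriers consume (★px6 g4 ✓`theta_rows_family_of_columnLetters`).  The cell's standard (RULING g28-№13∕№15) wants displayed rows
to be PRINT statements; this file supplies the two doors: each ∃-majorant row follows from the corresponding print KERNEL-DECAY row (pointwise, in the coarse-block ℓ¹ torus distance
`Site.tdist (B^{K−n}(b′)) ŷ`) by ONE counting fact — the fibre decomposition of the fine torus into `k`-blocks (✓`Prop7BlockBumpExtension.sum_comp_iterBlockOf`: each block carries
`3·L^{3(K−n)}` fine bonds) and the exponentially weighted torus sum ✓`Prop7TorusExpWeightSum.sum_exp_neg_mul_tdist_le` (`Σ_z e^{−a·tdist(z,ŷ)} ≤ (2(1+1∕a))³`, uniform in the volume).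

WHAT IS PROVED (ns `…Theorems.Prop7ColumnRowsOfKernelDecay`).
* §1 ★`sum_bond_exp_neg_tdist_block_le` — `Σ_{b′ : Bond 3 (periodsT3 F K)} e^{−a·tdist(B^{K−n}(b′), ŷ)} ≤ 3·(2(1+1∕a))³·(L^{K−n})³`;
  ★★`column_row_of_kernel_decay` — the GENERIC door at a member: a pointwise bound `‖Φ y Z b′‖ ≤ C·e^{−a·tdist}·‖Z‖` gives the ∃-majorant column row with `Θ := 3C(2(1+1∕a))³`.
* §2 ★★★`hHcol_of_kernel133_family` — S19ᴸ∕S20ᴸ's `hHcol` VERBATIM at `ΘH L := 3·CH L·(2(1 + 2∕δH L))³` from the displayed (3.133) row `h133` (rate `δH L∕2`, print's `½δ₁`);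
  ★★★`hΔHcol_of_kernel88_family` — `hΔHcol` VERBATIM at `ΘΔ L := 3·CΔ L·(2(1 + 1∕δΔ L))³` from the displayed (88)∕(3.132) row `h88` (rate `δΔ L`); `thetaH_nonneg`, `thetaΔ_nonneg` (the display's
  `hΘH0`∕`hΘΔ0` at these letters).
HONEST SCOPE.  Re-lettering + counting; the kernel-decay rows (3.133)∕(88) are N06-class and stay DISPLAYED (in print's currency instead of an ∃-majorant); no estimate on `H̃ᴾ` is proved here.

References: T. Bałaban, CMP **99** (1985) 389–434 [Balaban1985BackgroundPropagators] ((3.126) p.420, (3.132)–(3.133) p.422, Thm 3.12 p.423); CMP **102** (1985) 277–309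
[Balaban1985Variational] ((45)–(46) p.285, (86)–(88) p.291); CMP **96** (1984) 223–250 [Balaban1984PropagatorsII] ((2.61) p.234, the lattice sum).
-/

set_option autoImplicit false

noncomputable section

open scoped InnerProductSpace ComplexConjugate Matrix.Norms.L2Operator BigOperators

namespace Summit.QuantumFields.YangMills.Theorems.Prop7ColumnRowsOfKernelDecay

open Literature.MathematicalPhysics.QuantumFieldTheory.Balaban1983to89
open Literature.MathematicalPhysics.QuantumFieldTheory.Balaban1983to89.T3ContinuumYM3Torus
open Literature.MathematicalPhysics.QuantumFieldTheory.Balaban1983to89.T3Thm1Carrier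
open T3PrintedRegularMinimiser (RegPr)
open B9SectCLatticeCarrier (Bond)
open B11Eq115Space (NegSup NegSize Space115 JetSup levWeight)
open B11Eq111FrakG (nabla115)
open B11Eq90V0primeCurrent (flat115)
open B9Eq3119DeltaPiCarrier (currentCLM)
open B5Eq118OneStroke (iterBlockOf)
open Summit.QuantumFields.YangMills.Theorems.Prop7SectET3Transport (periodsT3 bondEquiv bgOfCfg)
open Summit.QuantumFields.YangMills.Theorems.Prop7SectET3HilbertLetters (frobEquiv)
open Summit.QuantumFields.YangMills.Theorems.Prop7SectET3CurvedPropagators (H1f)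
open Summit.QuantumFields.YangMills.Theorems.Prop7SectET3WilsonHessian (DeltaEtaSlot)
open Summit.QuantumFields.YangMills.Theorems.Prop7SectET3DeltaPiPInv (DeltaPiSlotP)

/-! ## §1 The counting fact: fine bonds by `k`-blocks against an exponential weight on the coarse torus -/

section Counting

variable (F : T3Family) (n K : ℕ) (h : n ≤ K)

/-- ★ **`Σ_{b′} e^{−a·tdist(B^{K−n}(b′), ŷ)} ≤ 3·(2(1+1∕a))³·(L^{K−n})³`** over the fine bonds `b′ : Bond 3 (periodsT3 F K)` of the member, for every coarse site `ŷ` and rate `a > 0`: the fine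
torus fibres over its `(K−n)`-blocks (`3·L^{3(K−n)}` bonds each, ✓`sum_comp_iterBlockOf`) and the weighted torus sum is `≤ (2(1+1∕a))³` (✓`sum_exp_neg_mul_tdist_le`).
[cite: Balaban1984PropagatorsII, (2.61) p.234; Balaban1984PropagatorsI, (1.6) p.18] -/
theorem sum_bond_exp_neg_tdist_block_le (yc : Site (F.P K) (K - n)) {a : ℝ} (ha : 0 < a) :
    ∑ b' : Bond 3 (periodsT3 F K), Real.exp (-(a * (Site.tdist (iterBlockOf (K - n) ((bondEquiv F K).symm b').src) yc : ℝ)))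
      ≤ 3 * (2 * (1 + 1 / a)) ^ 3 * ((F.L : ℝ) ^ (K - n)) ^ 3 := by
  have hk : K - n ≤ (F.P K).m + (F.P K).K := by
    show K - n ≤ F.m + K
    omega
  rw [(bondEquiv F K).symm.sum_comp (fun b : PBond (F.P K) 0 => Real.exp (-(a * (Site.tdist (iterBlockOf (K - n) b.src) yc : ℝ)))),
    Prop7BlockBumpExtension.sum_pbond_eq]
  simp only [Finset.sum_const, Finset.card_univ, Fintype.card_fin, nsmul_eq_mul]
  rw [← Finset.mul_sum, Prop7BlockBumpExtension.sum_comp_iterBlockOf hk (fun z : Site (F.P K) (K - n) => Real.exp (-(a * (Site.tdist z yc : ℝ))))]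
  have hsum := Prop7TorusExpWeightSum.sum_exp_neg_mul_tdist_le (P := F.P K) (j := K - n) yc ha
  have hd : (F.P K).d = 3 := rfl
  have hL : ((F.P K).L : ℝ) = (F.L : ℝ) := by rw [show (F.P K).L = F.L from rfl]
  rw [hd, hL] at *
  have hvol : 0 ≤ ((F.L : ℝ) ^ 3) ^ (K - n) := by positivity
  calc ((3 : ℕ) : ℝ) * (((F.L : ℝ) ^ 3) ^ (K - n) * ∑ z : Site (F.P K) (K - n), Real.exp (-(a * (Site.tdist z yc : ℝ))))
      ≤ (3 : ℝ) * (((F.L : ℝ) ^ 3) ^ (K - n) * (2 * (1 + 1 / a)) ^ 3) := by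
        rw [Nat.cast_ofNat]
        exact mul_le_mul_of_nonneg_left (mul_le_mul_of_nonneg_left hsum hvol) (by norm_num)
    _ = 3 * (2 * (1 + 1 / a)) ^ 3 * ((F.L : ℝ) ^ (K - n)) ^ 3 := by
        rw [← pow_mul, ← pow_mul, mul_comm 3 (K - n)]
        ring

/-- ★★ **THE GENERIC DOOR AT A MEMBER**: a POINTWISE kernel-decay bound `‖Φ y Z b′‖ ≤ C·e^{−a·tdist(B^{K−n}(b′), ŷ)}·‖Z‖` (`C ≥ 0`, `a > 0`, `ŷ` the coarse site of `y`) gives the ∃-MAJORANT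
column row «∃ hk ≥ 0, ‖Φ y Z b′‖ ≤ hk b′ y·‖Z‖, Σ_{b′} hk b′ y ≤ 3C(2(1+1∕a))³·(L^{K−n})³» (`hk := C·e^{−a·tdist}`). [cite: Balaban1985BackgroundPropagators, (3.133) p.422; Balaban1984PropagatorsII, (2.61) p.234] -/
theorem column_row_of_kernel_decay {E : Type*} [SeminormedAddCommGroup E]
    (Φ : PBond (F.P n) 0 → Matrix (Fin 2) (Fin 2) ℂ → Bond 3 (periodsT3 F K) → E) {C a : ℝ} (hC : 0 ≤ C) (ha : 0 < a)
    (hΦ : ∀ (y : PBond (F.P n) 0) (Z : Matrix (Fin 2) (Fin 2) ℂ) (b' : Bond 3 (periodsT3 F K)),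
      ‖Φ y Z b'‖ ≤ C * Real.exp (-(a * (Site.tdist (iterBlockOf (K - n) ((bondEquiv F K).symm b').src)
        (T3LevelShift.siteShift (T3PrintedRegularOrbits.sites_eq F n K h) y.src) : ℝ))) * ‖Z‖) :
    ∃ hk : Bond 3 (periodsT3 F K) → PBond (F.P n) 0 → ℝ, (∀ b' y, 0 ≤ hk b' y) ∧
      (∀ (y : PBond (F.P n) 0) (Z : Matrix (Fin 2) (Fin 2) ℂ) (b' : Bond 3 (periodsT3 F K)), ‖Φ y Z b'‖ ≤ hk b' y * ‖Z‖) ∧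
      (∀ y : PBond (F.P n) 0, ∑ b' : Bond 3 (periodsT3 F K), hk b' y ≤ 3 * C * (2 * (1 + 1 / a)) ^ 3 * ((F.L : ℝ) ^ (K - n)) ^ 3) := by
  refine ⟨fun b' y => C * Real.exp (-(a * (Site.tdist (iterBlockOf (K - n) ((bondEquiv F K).symm b').src)
      (T3LevelShift.siteShift (T3PrintedRegularOrbits.sites_eq F n K h) y.src) : ℝ))),
    fun b' y => mul_nonneg hC (Real.exp_pos _).le, fun y Z b' => hΦ y Z b', fun y => ?_⟩
  rw [← Finset.mul_sum]
  have hs := sum_bond_exp_neg_tdist_block_le F n K (T3LevelShift.siteShift (T3PrintedRegularOrbits.sites_eq F n K h) y.src) ha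
  calc C * ∑ b' : Bond 3 (periodsT3 F K), Real.exp (-(a * (Site.tdist (iterBlockOf (K - n) ((bondEquiv F K).symm b').src)
        (T3LevelShift.siteShift (T3PrintedRegularOrbits.sites_eq F n K h) y.src) : ℝ)))
      ≤ C * (3 * (2 * (1 + 1 / a)) ^ 3 * ((F.L : ℝ) ^ (K - n)) ^ 3) := mul_le_mul_of_nonneg_left hs hC
    _ = 3 * C * (2 * (1 + 1 / a)) ^ 3 * ((F.L : ℝ) ^ (K - n)) ^ 3 := by ring

end Counting

/-! ## §2 The two family doors at the EX display's letters -/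

section Family

/-- The door's `ΘH` is non-negative (the display's `hΘH0` at this letter). [folklore] -/
theorem thetaH_nonneg (CH δH : ℕ → ℝ) (hCH : ∀ L, 1 < L → 0 ≤ CH L) (hδH : ∀ L, 1 < L → 0 < δH L) :
    ∀ L, 1 < L → 0 ≤ 3 * CH L * (2 * (1 + 2 / δH L)) ^ 3 := by
  intro L hL
  have := hCH L hL
  have := hδH L hL
  positivity

/-- The door's `ΘΔ` is non-negative (the display's `hΘΔ0` at this letter). [folklore] -/
theorem thetaΔ_nonneg (CΔ δΔ : ℕ → ℝ) (hCΔ : ∀ L, 1 < L → 0 ≤ CΔ L) (hδΔ : ∀ L, 1 < L → 0 < δΔ L) :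
    ∀ L, 1 < L → 0 ≤ 3 * CΔ L * (2 * (1 + 1 / δΔ L)) ^ 3 := by
  intro L hL
  have := hCΔ L hL
  have := hδΔ L hL
  positivity

/-- ★★★ **DOOR «H-COLUMN»: S19ᴸ∕S20ᴸ's ∃-MAJORANT ROW `hHcol` FROM PRINT'S (3.133) KERNEL ROW FOR `H`** — at the member letters (`H̃ᴾ := H1f … (DeltaPiSlotP …) U₀`, one-block datum `Pi.single y Z`,
fine reading `flat115 · b′`), the displayed-to-be row `h133` «`‖H̃ᴾ(δ_yZ)(b′)‖ ≤ CH(L)·e^{−(δH(L)∕2)·d(B^{K−n}(b′), y)}·‖Z‖`» ([B9] (3.133) with `(L^{j′}η)^{−d} = 1` at the one-level member, `d` = the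
coarse-block ℓ¹ torus distance) gives `hHcol` VERBATIM with `ΘH L := 3·CH L·(2(1 + 2∕δH L))³`. [cite: Balaban1985BackgroundPropagators, (3.133) p.422, Thm 3.12 p.423, (3.126) p.420; Balaban1985Variational, (45)–(46) p.285] -/
theorem hHcol_of_kernel133_family
    [hFL : ∀ F : T3Family, Fact (0 < (F.L : ℝ))] [hFη : ∀ (F : T3Family) (k : ℕ), Fact (0 < ((F.L : ℝ)⁻¹) ^ k)]
    (α : ℕ → ℝ) (c₀ cB : ℕ → ℝ) [hc₀ : ∀ L : ℕ, Fact (0 < c₀ L)] [hcB : ∀ L : ℕ, Fact (0 < cB L)] (a : ∀ L : ℕ, Idx L → ℝ)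
    (CH δH : ℕ → ℝ) (hCH : ∀ L, 1 < L → 0 ≤ CH L) (hδH : ∀ L, 1 < L → 0 < δH L)
    (h133 : ∀ (L : ℕ), 1 < L → ∀ (i : Idx L) (U₀ : GaugeField (i.1.1.P i.1.2.2) 0 (Matrix.specialUnitaryGroup (Fin 2) ℂ)), RegPr i.1.1 i.1.2.1 i.1.2.2 (α L) U₀ →
      ∀ (y : PBond (i.1.1.P i.1.2.1) 0) (Z : Matrix (Fin 2) (Fin 2) ℂ) (b' : Bond 3 (periodsT3 i.1.1 i.1.2.2)),
        ‖flat115 ((H1f i.1.1 i.1.2.1 i.1.2.2 i.2.2.le (c₀ L) (cB L) (a L i) (DeltaPiSlotP i.1.1 i.1.2.1 i.1.2.2 i.2.2.le (c₀ L) (cB L) (a L i)) U₀) (Pi.single y Z)) b'‖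
          ≤ CH L * Real.exp (-(δH L / 2 * (Site.tdist (B5Eq118OneStroke.iterBlockOf (i.1.2.2 - i.1.2.1) ((bondEquiv i.1.1 i.1.2.2).symm b').src) (T3LevelShift.siteShift (T3PrintedRegularOrbits.sites_eq i.1.1 i.1.2.1 i.1.2.2 i.2.2.le) y.src) : ℝ))) * ‖Z‖) :
    ∀ (L : ℕ), 1 < L → ∀ (i : Idx L) (U₀ : GaugeField (i.1.1.P i.1.2.2) 0 (Matrix.specialUnitaryGroup (Fin 2) ℂ)), RegPr i.1.1 i.1.2.1 i.1.2.2 (α L) U₀ →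
      ∃ hk : Bond 3 (periodsT3 i.1.1 i.1.2.2) → PBond (i.1.1.P i.1.2.1) 0 → ℝ, (∀ b' y, 0 ≤ hk b' y) ∧
        (∀ (y : PBond (i.1.1.P i.1.2.1) 0) (Z : Matrix (Fin 2) (Fin 2) ℂ) (b' : Bond 3 (periodsT3 i.1.1 i.1.2.2)), ‖flat115 ((H1f i.1.1 i.1.2.1 i.1.2.2 i.2.2.le (c₀ L) (cB L) (a L i) (DeltaPiSlotP i.1.1 i.1.2.1 i.1.2.2 i.2.2.le (c₀ L) (cB L) (a L i)) U₀) (Pi.single y Z)) b'‖ ≤ hk b' y * ‖Z‖) ∧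
        (∀ y : PBond (i.1.1.P i.1.2.1) 0, ∑ b' : Bond 3 (periodsT3 i.1.1 i.1.2.2), hk b' y ≤ (3 * CH L * (2 * (1 + 2 / δH L)) ^ 3) * ((L : ℝ) ^ (i.1.2.2 - i.1.2.1)) ^ 3) := by
  intro L hL i U₀ hreg
  have hFL' : (i.1.1.L : ℝ) = (L : ℝ) := by rw [i.2.1]
  have hδ : 0 < δH L / 2 := by have := hδH L hL; positivity
  obtain ⟨hk, hk0, hkb, hks⟩ := column_row_of_kernel_decay i.1.1 i.1.2.1 i.1.2.2 i.2.2.le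
    (fun (y : PBond (i.1.1.P i.1.2.1) 0) (Z : Matrix (Fin 2) (Fin 2) ℂ) (b' : Bond 3 (periodsT3 i.1.1 i.1.2.2)) => flat115 ((H1f i.1.1 i.1.2.1 i.1.2.2 i.2.2.le (c₀ L) (cB L) (a L i) (DeltaPiSlotP i.1.1 i.1.2.1 i.1.2.2 i.2.2.le (c₀ L) (cB L) (a L i)) U₀) (Pi.single y Z)) b')
    (hCH L hL) hδ (fun y Z b' => h133 L hL i U₀ hreg y Z b')
  refine ⟨hk, hk0, hkb, fun y => ?_⟩
  have e : 1 / (δH L / 2) = 2 / δH L := by rw [one_div_div]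
  rw [← hFL', ← e]
  exact hks y

/-- ★★★ **DOOR «ΔH-COLUMN»: S19ᴸ∕S20ᴸ's ∃-MAJORANT ROW `hΔHcol` FROM PRINT'S (88)∕(3.132) KERNEL ROW FOR THE COMPOSITE `(Δ_π + DRD*)H = Q*(QGQ*)⁻¹ − Q*aQH`** — at the member letters
(the composite `Δ̃^η ∘ H̃ᴾ` read through `currentCLM … (DeltaEtaSlot …)` and `NegSup.equiv … b′`), the displayed-to-be row `h88` «`‖(Δ̃^η H̃ᴾ(δ_yZ))(b′)‖ ≤ CΔ(L)·e^{−δΔ(L)·d(B^{K−n}(b′), y)}·‖Z‖`»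
gives `hΔHcol` VERBATIM with `ΘΔ L := 3·CΔ L·(2(1 + 1∕δΔ L))³`. [cite: Balaban1985Variational, (86)–(88) p.291; Balaban1985BackgroundPropagators, (3.132) p.422, Thm 3.12 p.423] -/
theorem hΔHcol_of_kernel88_family
    [hFL : ∀ F : T3Family, Fact (0 < (F.L : ℝ))] [hFη : ∀ (F : T3Family) (k : ℕ), Fact (0 < ((F.L : ℝ)⁻¹) ^ k)]
    (α : ℕ → ℝ) (c₀ cB : ℕ → ℝ) [hc₀ : ∀ L : ℕ, Fact (0 < c₀ L)] [hcB : ∀ L : ℕ, Fact (0 < cB L)] (a : ∀ L : ℕ, Idx L → ℝ)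
    (CΔ δΔ : ℕ → ℝ) (hCΔ : ∀ L, 1 < L → 0 ≤ CΔ L) (hδΔ : ∀ L, 1 < L → 0 < δΔ L)
    (h88 : ∀ (L : ℕ), 1 < L → ∀ (i : Idx L) (U₀ : GaugeField (i.1.1.P i.1.2.2) 0 (Matrix.specialUnitaryGroup (Fin 2) ℂ)), RegPr i.1.1 i.1.2.1 i.1.2.2 (α L) U₀ →
      ∀ (y : PBond (i.1.1.P i.1.2.1) 0) (Z : Matrix (Fin 2) (Fin 2) ℂ) (b' : Bond 3 (periodsT3 i.1.1 i.1.2.2)),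
        ‖NegSup.equiv (levWeight (i.1.1.L : ℝ) (((i.1.1.L : ℝ)⁻¹) ^ (i.1.2.2 - i.1.2.1)) (fun _ : Bond 3 (periodsT3 i.1.1 i.1.2.2) => i.1.2.2 - i.1.2.1) 3) (Matrix (Fin 2) (Fin 2) ℂ) ((currentCLM frobEquiv (fun _ : Bond 3 (periodsT3 i.1.1 i.1.2.2) × Fin 3 => i.1.2.2 - i.1.2.1) (nabla115 (((i.1.1.L : ℝ)⁻¹) ^ (i.1.2.2 - i.1.2.1)) (bgOfCfg i.1.1 i.1.2.2 U₀)) (DeltaEtaSlot i.1.1 i.1.2.1 i.1.2.2 (c₀ L) U₀)) ((H1f i.1.1 i.1.2.1 i.1.2.2 i.2.2.le (c₀ L) (cB L) (a L i) (DeltaPiSlotP i.1.1 i.1.2.1 i.1.2.2 i.2.2.le (c₀ L) (cB L) (a L i)) U₀) (Pi.single y Z))) b'‖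
          ≤ CΔ L * Real.exp (-(δΔ L * (Site.tdist (B5Eq118OneStroke.iterBlockOf (i.1.2.2 - i.1.2.1) ((bondEquiv i.1.1 i.1.2.2).symm b').src) (T3LevelShift.siteShift (T3PrintedRegularOrbits.sites_eq i.1.1 i.1.2.1 i.1.2.2 i.2.2.le) y.src) : ℝ))) * ‖Z‖) :
    ∀ (L : ℕ), 1 < L → ∀ (i : Idx L) (U₀ : GaugeField (i.1.1.P i.1.2.2) 0 (Matrix.specialUnitaryGroup (Fin 2) ℂ)), RegPr i.1.1 i.1.2.1 i.1.2.2 (α L) U₀ →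
      ∃ hk' : Bond 3 (periodsT3 i.1.1 i.1.2.2) → PBond (i.1.1.P i.1.2.1) 0 → ℝ, (∀ b' y, 0 ≤ hk' b' y) ∧
        (∀ (y : PBond (i.1.1.P i.1.2.1) 0) (Z : Matrix (Fin 2) (Fin 2) ℂ) (b' : Bond 3 (periodsT3 i.1.1 i.1.2.2)), ‖NegSup.equiv (levWeight (i.1.1.L : ℝ) (((i.1.1.L : ℝ)⁻¹) ^ (i.1.2.2 - i.1.2.1)) (fun _ : Bond 3 (periodsT3 i.1.1 i.1.2.2) => i.1.2.2 - i.1.2.1) 3) (Matrix (Fin 2) (Fin 2) ℂ) ((currentCLM frobEquiv (fun _ : Bond 3 (periodsT3 i.1.1 i.1.2.2) × Fin 3 => i.1.2.2 - i.1.2.1) (nabla115 (((i.1.1.L : ℝ)⁻¹) ^ (i.1.2.2 - i.1.2.1)) (bgOfCfg i.1.1 i.1.2.2 U₀)) (DeltaEtaSlot i.1.1 i.1.2.1 i.1.2.2 (c₀ L) U₀)) ((H1f i.1.1 i.1.2.1 i.1.2.2 i.2.2.le (c₀ L) (cB L) (a L i) (DeltaPiSlotP i.1.1 i.1.2.1 i.1.2.2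 i.2.2.le (c₀ L) (cB L) (a L i)) U₀) (Pi.single y Z))) b'‖ ≤ hk' b' y * ‖Z‖) ∧
        (∀ y : PBond (i.1.1.P i.1.2.1) 0, ∑ b' : Bond 3 (periodsT3 i.1.1 i.1.2.2), hk' b' y ≤ (3 * CΔ L * (2 * (1 + 1 / δΔ L)) ^ 3) * ((L : ℝ) ^ (i.1.2.2 - i.1.2.1)) ^ 3) := by
  intro L hL i U₀ hreg
  have hFL' : (i.1.1.L : ℝ) = (L : ℝ) := by rw [i.2.1]
  obtain ⟨hk, hk0, hkb, hks⟩ := column_row_of_kernel_decay i.1.1 i.1.2.1 i.1.2.2 i.2.2.le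
    (fun (y : PBond (i.1.1.P i.1.2.1) 0) (Z : Matrix (Fin 2) (Fin 2) ℂ) (b' : Bond 3 (periodsT3 i.1.1 i.1.2.2)) => NegSup.equiv (levWeight (i.1.1.L : ℝ) (((i.1.1.L : ℝ)⁻¹) ^ (i.1.2.2 - i.1.2.1)) (fun _ : Bond 3 (periodsT3 i.1.1 i.1.2.2) => i.1.2.2 - i.1.2.1) 3) (Matrix (Fin 2) (Fin 2) ℂ) ((currentCLM frobEquiv (fun _ : Bond 3 (periodsT3 i.1.1 i.1.2.2) × Fin 3 => i.1.2.2 - i.1.2.1) (nabla115 (((i.1.1.L : ℝ)⁻¹) ^ (i.1.2.2 - i.1.2.1)) (bgOfCfg i.1.1 i.1.2.2 U₀)) (DeltaEtaSlot i.1.1 i.1.2.1 i.1.2.2 (c₀ L) U₀)) ((H1f i.1.1 i.1.2.1 i.1.2.2 i.2.2.le (c₀ L) (cB L) (a L i) (DeltaPiSlotP i.1.1 i.1.2.1 i.1.2.2 i.2.2.le (c₀ L) (cB L) (a L i)) U₀) (Pi.single y Z))) b')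
    (hCΔ L hL) (hδΔ L hL) (fun y Z b' => h88 L hL i U₀ hreg y Z b')
  refine ⟨hk, hk0, hkb, fun y => ?_⟩
  rw [← hFL']
  exact hks y

end Family

end Summit.QuantumFields.YangMills.Theorems.Prop7ColumnRowsOfKernelDecay

end
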